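import Summits.AtomisticToContinuum.HydrodynamicLimit.Theorems.BoxDissipativeWeakStrongLocalGibbsFineScaleStaticsPrelim
import Summits.AtomisticToContinuum.HydrodynamicLimit.Theorems.BoxDissipativeWeakStrongLocalGibbsFineScaleUniformOnePt
import Summits.AtomisticToContinuum.HydrodynamicLimit.Theorems.StiffCollisionalRelaxationAprioriBoundsMesoMeanFloorEquilibrium
import Summits.AtomisticToContinuum.HydrodynamicLimit.Theorems.JaynesSqueezeBlockGibbsToRelEntropyCore
import HarnessLib

/-!
# The in-mean floor and ceiling of the kernel block density at time zero, for all nice profiles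
(line `meso-chebyshev-window`, crux `StiffCollisionalRelaxation.AprioriBounds`, stmt-AtomisticToContinuum-14827)

Helper file (`--supports stmt-AtomisticToContinuum-14827`): the `t = 0` rung of the registered stubs
`stub_meanFloor` (stub 1) and `stub_meanCeiling` (stub 2) of the line, for EVERY continuous positive
(inhomogeneous) profile `(a₀, u₀, θ₀)` (the equilibrium rung, constant profiles at all times, is
`meanFloor_equilibrium`).

The stubs ask for bounds on the MEAN of the kernel block density
`ρ̄_φ(s,x)(z) = empiricalDensityField ((Φ N).flow s z) (fun y => φ N (y - x)) = (N+1)⁻¹ ∑ᵢ φ_N(qᵢ(s) − x)`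
under the local Gibbs law `P_N = localGibbsLaw σ a₀ u₀ θ₀ N (Φ N)`.  At `s = 0`:

* the flow is the identity `P_N`-a.s. (`JaynesSqueezeClosure.integral_comp_flow_zero`), the position marginal of `P_N`
  is the configurational canonical hard-sphere measure `posGibbsMeasure a₀ ε_N (N+1)`
  (`LGFS.map_pos_localGibbsMeasure`), so the mean block density is the mean of the kernel average
  `(N+1)⁻¹ ∑ᵢ φ(qᵢ − x)` under `posGibbsMeasure` (`tzMean_integral_blockDensity_flow_zero_eq_posGibbs`), i.e.
  the canonical ONE-POINT function `onePt (profileOf a₀) σ (φ(· − x)) N 0`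
  (`tzMean_integral_blockDensity_flow_zero_eq_onePt`, via `LGFS.integral_avg_posGibbs_eq_onePt`);
* CEILING (`tzMean_meanCeiling_timeZero`): Ruelle's bound `E ≤ 2M`, `M = sup a₀/∫a₀`
  (`LGFS.integral_avg_posGibbs_le`, small density), so `E · σ³ ≤ 1/2` once `σ ≤ 1` and `σ ≤ 1/(4M)`;
* FLOOR (`tzMean_meanFloor_timeZero`): for admissible kernel families (continuous, `≥ 0`, mass `1`,
  supported in the minimal-image ball of radius `(N+1)^{-γ}`, height `≤ C (N+1)^{3γ}`) the one-point
  function converges to the identified limit density `ρ₀ = rhoLim (profileOf a₀) σ` UNIFORMLY in the centre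
  (`LGFS.onePt_kernel_uniform`); `ρ₀` is continuous and positive once `σ` is small enough that
  `4eMθ/(1−θ) < min β` (`exists_smallDensity`, `SmallDensity.rhoLim_pos`), so with `ρ_min = min ρ₀ > 0` the
  mean is eventually `≥ ρ_min / 2 =: m`, uniformly in the centre, the flow family and the kernel family;
  `m` depends on the profiles and `σ` only.

No new definitions, no named facts; axioms `propext`, `Classical.choice`, `Quot.sound`.
-/

noncomputable section

open MeasureTheory ProbabilityTheory Filter Set Topology
open scoped ENNReal

namespace Summit.AtomisticToContinuum.HydrodynamicLimit.Theorems.MesoChebyshevWindow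

open Literature.MathematicalPhysics.KineticTheory Literature.Analysis.FluidPDE

/-! ## Small facts -/

/-- Mathlib's (sup) distance on `𝕋³` is dominated by the minimal-image distance in the crux's
orientation: `dist y x ≤ euclidDist (y - x) 0`. [folklore] -/
theorem tzMean_dist_le_euclidDist_sub_zero (y x : T3) : dist y x ≤ Torus.euclidDist (y - x) 0 := by
  rw [MesoLLN.euclidDist_sub_zero, dist_eq_norm]
  exact Torus.norm_sub_le_euclidDist_holds y x

/-! ## Time zero: the mean block density is the canonical one-point function -/

/-- **The mean block density at time zero is a configurational canonical average.**  For continuous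
positive profiles, every `σ`, `N`, flow `Φ`, continuous kernel `φ` and centre `x`:
`E_{P_N} ρ̄_φ(0, x) = ∫ (N+1)⁻¹ ∑ᵢ φ(qᵢ − x) d(posGibbsMeasure a₀ ε_N (N+1))` (flow at time `0` is the
identity a.s.; position marginal of the local Gibbs law). [folklore] -/
theorem tzMean_integral_blockDensity_flow_zero_eq_posGibbs {a₀ θ₀ : T3 → ℝ} {u₀ : T3 → V3}
    (ha : Continuous a₀) (hθ : Continuous θ₀) (hu : Continuous u₀) (ha0 : ∀ x, 0 < a₀ x)
    (hθ0 : ∀ x, 0 < θ₀ x) (σ : ℝ) (N : ℕ)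
    (Φ : HardSphereFlow (Torus.geometry (Fin 3)) (hsDiameter σ N) (N + 1)) {φ : T3 → ℝ}
    (hφ : Continuous φ) (x : T3) :
    ∫ z, empiricalDensityField (Φ.flow 0 z) (fun y => φ (y - x)) ∂(localGibbsLaw σ a₀ u₀ θ₀ N Φ) =
      ∫ q, ((((N + 1 : ℕ) : ℝ))⁻¹ * ∑ i, φ (q i - x)) ∂posGibbsMeasure a₀ (hsDiameter σ N) (N + 1) := by
  have hg : Measurable fun y => φ (y - x) := (hφ.comp (continuous_sub_right x)).measurable
  have hGm : Measurable fun q : Fin (N + 1) → T3 => ((N + 1 : ℕ) : ℝ)⁻¹ * ∑ i, φ (q i - x) :=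
    measurable_const.mul (Finset.measurable_sum _ fun i _ => hg.comp (measurable_pi_apply i))
  rw [JaynesSqueezeClosure.integral_comp_flow_zero N Φ fun z => empiricalDensityField z (fun y => φ (y - x)),
    localGibbsLaw_eq, ← LGFS.map_pos_localGibbsMeasure ha hθ hu (fun y => (ha0 y).le) hθ0 σ N,
    integral_map (LGFS.measurable_posProj (N + 1)).aemeasurable hGm.aestronglyMeasurable]
  refine integral_congr_ae (ae_of_all _ fun z => ?_)
  exact AprioriBoundsNegative.blockDensity_eq z φ x

/-- **The mean block density at time zero is the canonical one-point function**
`E_{P_N} ρ̄_φ(0, x) = onePt (profileOf a₀) σ (φ(· − x)) N 0`. [folklore] -/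
theorem tzMean_integral_blockDensity_flow_zero_eq_onePt {a₀ θ₀ : T3 → ℝ} {u₀ : T3 → V3}
    (ha : Continuous a₀) (hθ : Continuous θ₀) (hu : Continuous u₀) (ha0 : ∀ x, 0 < a₀ x)
    (hθ0 : ∀ x, 0 < θ₀ x) (σ : ℝ) (N : ℕ)
    (Φ : HardSphereFlow (Torus.geometry (Fin 3)) (hsDiameter σ N) (N + 1)) {φ : T3 → ℝ}
    (hφ : Continuous φ) (x : T3) :
    ∫ z, empiricalDensityField (Φ.flow 0 z) (fun y => φ (y - x)) ∂(localGibbsLaw σ a₀ u₀ θ₀ N Φ) =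
      onePt (profileOf a₀ ha ha0) σ (fun y => φ (y - x)) N 0 := by
  obtain ⟨K, -, hK⟩ := exists_forall_abs_le_of_continuous hφ
  have hg : Measurable fun y => φ (y - x) := (hφ.comp (continuous_sub_right x)).measurable
  rw [tzMean_integral_blockDensity_flow_zero_eq_posGibbs ha hθ hu ha0 hθ0 σ N Φ hφ x]
  exact LGFS.integral_avg_posGibbs_eq_onePt ha ha0 σ N hg fun y => hK (y - x)

/-! ## The ceiling in the mean at time zero -/

/-- CEILING IN THE MEAN AT t = 0, every nice profile, every N, every flow: E_{P_N} ρ̄_φ(0,x) · σ³ ≤ 1/2 once σ³ ≤ 1/(4M), M = sup a₀/∫a₀ (Ruelle's one-point bound E ≤ 2M·(kernel mass)). [folklore] -/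
theorem tzMean_meanCeiling_timeZero : ∀ (a₀ θ₀ : T3 → ℝ) (u₀ : T3 → V3), Continuous a₀ → Continuous θ₀ → Continuous u₀ → (∀ x, 0 < a₀ x) → (∀ x, 0 < θ₀ x) → ∃ σ₀ : ℝ, 0 < σ₀ ∧ ∀ σ : ℝ, 0 < σ → σ < σ₀ → ∀ (N : ℕ) (Φ : HardSphereFlow (Torus.geometry (Fin 3)) (hsDiameter σ N) (N + 1)) (φ : T3 → ℝ) (K : ℝ), Continuous φ → (∀ y, 0 ≤ φ y) → (∀ y, φ y ≤ K) → ∫ y, φ y = 1 → ∀ x : T3, (∫ z, empiricalDensityField (Φ.flow 0 z) (fun y => φ (y - x)) ∂(localGibbsLaw σ a₀ u₀ θ₀ N Φ)) * σ ^ 3 ≤ 1 / 2 := by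
  intro a₀ θ₀ u₀ ha hθ hu ha0 hθ0
  have hM : 0 < (profileOf a₀ ha ha0).M := (profileOf a₀ ha ha0).M_pos
  obtain ⟨σ₁, hσ₁, hsd⟩ := exists_smallDensity (profileOf a₀ ha ha0) one_pos
  refine ⟨min σ₁ (min 1 (1 / (4 * (profileOf a₀ ha ha0).M))),
    lt_min hσ₁ (lt_min one_pos (by positivity)), ?_⟩
  intro σ hσ hσlt N Φ φ K hφ hφ0 hφK hφ1 x
  have hσσ₁ : σ < σ₁ := hσlt.trans_le (min_le_left _ _)
  have hσ1 : σ ≤ 1 := (hσlt.trans_le ((min_le_right _ _).trans (min_le_left _ _))).le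
  have hσM : σ ≤ 1 / (4 * (profileOf a₀ ha ha0).M) :=
    (hσlt.trans_le ((min_le_right _ _).trans (min_le_right _ _))).le
  have hs : SmallDensity (profileOf a₀ ha ha0) σ := (hsd σ hσ hσσ₁).1
  have hg : Measurable fun y => φ (y - x) := (hφ.comp (continuous_sub_right x)).measurable
  -- Ruelle's bound on the one-point function
  have hE : ∫ z, empiricalDensityField (Φ.flow 0 z) (fun y => φ (y - x)) ∂(localGibbsLaw σ a₀ u₀ θ₀ N Φ) ≤
      2 * (profileOf a₀ ha ha0).M := by
    rw [tzMean_integral_blockDensity_flow_zero_eq_posGibbs ha hθ hu ha0 hθ0 σ N Φ hφ x]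
    exact LGFS.integral_avg_posGibbs_le ha ha0 hs N hg (fun y => hφ0 (y - x)) (fun y => hφK (y - x))
      (MesoLLN.integral_translate_eq_one' hφ1 x)
  -- arithmetic: `2M σ³ ≤ 2M σ ≤ 2M / (4M) = 1/2`
  have hσ3 : σ ^ 3 ≤ 1 / (4 * (profileOf a₀ ha ha0).M) :=
    (pow_le_of_le_one hσ.le hσ1 three_ne_zero).trans hσM
  calc (∫ z, empiricalDensityField (Φ.flow 0 z) (fun y => φ (y - x)) ∂(localGibbsLaw σ a₀ u₀ θ₀ N Φ)) * σ ^ 3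
      ≤ 2 * (profileOf a₀ ha ha0).M * σ ^ 3 := mul_le_mul_of_nonneg_right hE (pow_nonneg hσ.le 3)
    _ ≤ 2 * (profileOf a₀ ha ha0).M * (1 / (4 * (profileOf a₀ ha ha0).M)) :=
        mul_le_mul_of_nonneg_left hσ3 (by positivity)
    _ = 1 / 2 := by
        field_simp
        ring

/-! ## The floor in the mean at time zero -/

/-- FLOOR IN THE MEAN AT t = 0, every nice profile, eventually in N, uniformly in the centre and in admissible kernel families: m := (min ρ₀)/2 with ρ₀ = rhoLim (profileOf a₀) σ the identified LLN density (uniform one-point limit `LGFS.onePt_kernel_uniform`). [folklore] -/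
theorem tzMean_meanFloor_timeZero : ∀ (a₀ θ₀ : T3 → ℝ) (u₀ : T3 → V3), Continuous a₀ → Continuous θ₀ → Continuous u₀ → (∀ x, 0 < a₀ x) → (∀ x, 0 < θ₀ x) → ∃ σ₀ : ℝ, 0 < σ₀ ∧ ∀ σ : ℝ, 0 < σ → σ < σ₀ → ∃ m : ℝ, 0 < m ∧ ∀ (Φ : (N : ℕ) → HardSphereFlow (Torus.geometry (Fin 3)) (hsDiameter σ N) (N + 1)) (γ C : ℝ) (φ : ℕ → T3 → ℝ), 0 < γ → (∀ N, Continuous (φ N)) → (∀ N y, 0 ≤ φ N y) → (∀ N, ∫ y, φ N y = 1) → (∀ (N : ℕ) y, ((N : ℝ) + 1) ^ (-γ) ≤ Torus.euclidDist y 0 → φ N y = 0) → (∀ (N : ℕ) y, φ N y ≤ C * ((N : ℝ) + 1) ^ (3 * γ)) → ∃ N₀ : ℕ, ∀ N : ℕ, N₀ ≤ N → ∀ x : T3, m ≤ ∫ z, empiricalDensityField ((Φ N).flow 0 z) (fun y => φ N (y - x)) ∂(localGibbsLaw σ a₀ u₀ θ₀ N (Φ N)) := by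
  intro a₀ θ₀ u₀ ha hθ hu ha0 hθ0
  -- small density with `4eMθ/(1-θ) < min β`, so that the limit density is positive everywhere
  obtain ⟨b, hb, hbβ⟩ := JaynesSqueezeClosure.exists_pos_lower_bound (profileOf a₀ ha ha0).continuous
    (profileOf a₀ ha ha0).pos
  obtain ⟨σ₁, hσ₁, hsd⟩ := exists_smallDensity (profileOf a₀ ha ha0) hb
  refine ⟨σ₁, hσ₁, fun σ hσ hσlt => ?_⟩
  obtain ⟨hs, hsmall⟩ := hsd σ hσ hσlt
  have hρpos : ∀ x, 0 < rhoLim (profileOf a₀ ha ha0) σ x := fun x =>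
    hs.rhoLim_pos (hsmall.trans_le (hbβ x))
  obtain ⟨ρm, hρm, hρ⟩ := JaynesSqueezeClosure.exists_pos_lower_bound hs.continuous_rhoLim hρpos
  refine ⟨ρm / 2, half_pos hρm, ?_⟩
  intro Φ γ C φ hγ hφc hφ0 hφ1 hsupp hφC
  -- the admissible family as a family of centred kernels `g N x y = φ N (y - x)`
  have hgm : ∀ (N : ℕ) (x : T3), Measurable fun y => φ N (y - x) := fun N x =>
    ((hφc N).comp (continuous_sub_right x)).measurable
  have hg0 : ∀ (N : ℕ) (x y : T3), 0 ≤ φ N (y - x) := fun N x y => hφ0 N _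
  have hgC : ∀ (N : ℕ) (x y : T3), φ N (y - x) ≤ C * ((N : ℝ) + 1) ^ (3 * γ) := fun N x y => hφC N _
  have hg1 : ∀ (N : ℕ) (x : T3), ∫ y, φ N (y - x) = 1 := fun N x =>
    MesoLLN.integral_translate_eq_one' (hφ1 N) x
  have hsupp' : ∀ (N : ℕ) (x y : T3), φ N (y - x) ≠ 0 → dist y x < ((N : ℝ) + 1) ^ (-γ) := by
    intro N x y hne
    by_contra hle
    exact hne (hsupp N (y - x) ((not_lt.1 hle).trans (tzMean_dist_le_euclidDist_sub_zero y x)))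
  have hr : Tendsto (fun N : ℕ => ((N : ℝ) + 1) ^ (-γ)) atTop (𝓝 0) :=
    (tendsto_rpow_neg_atTop hγ).comp (tendsto_atTop_add_const_right atTop 1 tendsto_natCast_atTop_atTop)
  -- the uniform one-point limit with `δ = ρ_min / 2`
  obtain ⟨N₀, hN₀⟩ := eventually_atTop.1 (LGFS.onePt_kernel_uniform hs
    (g := fun N x y => φ N (y - x)) (Cg := fun N => C * ((N : ℝ) + 1) ^ (3 * γ))
    (r := fun N => ((N : ℝ) + 1) ^ (-γ)) hgm hg0 hgC hg1 hsupp' hr 0 (half_pos hρm))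
  refine ⟨N₀, fun N hN x => ?_⟩
  rw [tzMean_integral_blockDensity_flow_zero_eq_onePt ha hθ hu ha0 hθ0 σ N (Φ N) (hφc N) x]
  have h : |onePt (profileOf a₀ ha ha0) σ (fun y => φ N (y - x)) N 0 - rhoLim (profileOf a₀ ha ha0) σ x| ≤
      ρm / 2 := hN₀ N hN x
  have hx := hρ x
  rw [abs_le] at h
  linarith [h.1]

end Summit.AtomisticToContinuum.HydrodynamicLimit.Theorems.MesoChebyshevWindow

end
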